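import Mathlib.LinearAlgebra.Eigenspace.Triangularizable
import Mathlib.Analysis.Complex.Polynomial.Basic
import Mathlib.Tactic.Module
import HarnessLib

/-!
# Highest weight vectors in locally finite modules over the `𝔤𝔩₂(ℂ)` torus pair

Elementary linear algebra behind the classification of the `U(2)`-types of a representation of
`GL₂(ℂ)` (Humphreys, *Introduction to Lie Algebras*, §7.2; Knapp, *Lie Groups Beyond an
Introduction*, §I.9): let `E, K₁, K₂` be endomorphisms of a complex vector space `V` with
`[K₁, E] = E`, `[K₂, E] = -E`, `[K₁, K₂] = 0` (the raising operator and the two torus generators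
of `𝔤𝔩₂(ℂ) ≅ 𝔲(2)_ℂ`), and let `U ≠ 0` be a finite-dimensional subspace stable under the three
operators. Then `U` contains a **highest weight vector**: a common eigenvector of `K₁, K₂`
killed by `E` (`exists_highestWeightVector`). For an `𝔰𝔩₂`-triple `(E, F, H)` and a highest
weight vector `v` of `H`-weight `μ` lying in a finite-dimensional `F`-stable subspace, the weight
is a natural number `n` and `F ^ (n + 1) v = 0` (`weight_eq_nat_of_highestWeightVector`).

Only the subspace `U` is assumed finite-dimensional (the ambient module is typically an
infinite-dimensional space of automorphic forms), so Mathlib's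
`IsSl2Triple.HasPrimitiveVectorWith.exists_nat` (Noetherian ambient module) and
`Module.End.exists_eigenvalue` (finite-dimensional ambient module) are applied after transporting
the relevant strings of weight vectors into `U`.

## References

* J. E. Humphreys, *Introduction to Lie Algebras and Representation Theory*, GTM 9, §7.2.
* A. W. Knapp, *Lie Groups Beyond an Introduction*, 2nd ed. (2002), §I.9.
-/

namespace Literature.Algebra.Lie.GL2Pair

open Module

/-- Two commuting endomorphisms of a non-zero finite-dimensional complex vector space have a
common eigenvector. [folklore] -/
private lemma exists_common_eigenvector {W : Type*} [AddCommGroup W] [Module ℂ W]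
    [FiniteDimensional ℂ W] [Nontrivial W] (A B : Module.End ℂ W) (hAB : A * B = B * A) :
    ∃ w : W, w ≠ 0 ∧ ∃ a b : ℂ, A w = a • w ∧ B w = b • w := by
  obtain ⟨a, ha⟩ := A.exists_eigenvalue
  have hmaps : ∀ x ∈ A.eigenspace a, B x ∈ A.eigenspace a := by
    intro x hx
    rw [Module.End.mem_eigenspace_iff] at hx ⊢
    rw [← Module.End.mul_apply, hAB, Module.End.mul_apply, hx, map_smul]
  haveI : Nontrivial (A.eigenspace a) := Submodule.nontrivial_iff_ne_bot.mpr ha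
  obtain ⟨b, hb⟩ := Module.End.exists_eigenvalue (B.restrict hmaps)
  obtain ⟨w, hw⟩ := hb.exists_hasEigenvector
  refine ⟨(w : W), fun h => hw.2 (Subtype.ext h), a, b, Module.End.mem_eigenspace_iff.mp w.2, ?_⟩
  have h := congrArg Subtype.val hw.apply_eq_smul
  simpa only [LinearMap.coe_restrict_apply, Submodule.coe_smul] using h

/-- In a finite-dimensional subspace `U`, a sequence of vectors `u r ∈ U` with
`T (u r) = c r • u r` for pairwise distinct scalars `c r` has a zero term. [folklore] -/
private lemma exists_eq_zero_of_weights_injective {V : Type*} [AddCommGroup V] [Module ℂ V]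
    (T : Module.End ℂ V) (U : Submodule ℂ V) [FiniteDimensional ℂ U] (u : ℕ → V) (c : ℕ → ℂ)
    (hc : Function.Injective c) (hU : ∀ r, u r ∈ U) (hT : ∀ r, T (u r) = c r • u r) :
    ∃ r, u r = 0 := by
  by_contra! h
  have hli : LinearIndependent ℂ u :=
    T.eigenvectors_linearIndependent' c hc u fun r =>
      Module.End.hasEigenvector_iff.mpr ⟨Module.End.mem_eigenspace_iff.mpr (hT r), h r⟩
  have hli' : LinearIndependent ℂ (fun r => (⟨u r, hU r⟩ : U)) :=
    LinearIndependent.of_comp U.subtype hli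
  haveI : Finite ℕ := hli'.finite
  exact not_finite ℕ

/-- Weights along an arithmetic progression are pairwise distinct. [folklore] -/
private lemma injective_weights (c s : ℂ) (hs : s ≠ 0) :
    Function.Injective fun r : ℕ => c + r * s := by
  intro a b hab
  simp only [add_right_inj] at hab
  exact_mod_cast mul_right_cancel₀ hs hab

/-- The ladder: if `T (E x) = E (T x) + s • E x` for all `x`, then `E ^ r` shifts `T`-weights
by `r * s`. [folklore] -/
private lemma weight_pow_apply {V : Type*} [AddCommGroup V] [Module ℂ V]
    (E T : Module.End ℂ V) (s : ℂ) (hTE : ∀ x, T (E x) = E (T x) + s • E x) {x : V} {c : ℂ}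
    (hx : T x = c • x) (r : ℕ) : T ((E ^ r) x) = (c + r * s) • (E ^ r) x := by
  induction r with
  | zero => simp [hx]
  | succ r ih =>
    rw [pow_succ', Module.End.mul_apply, hTE, ih, map_smul, ← add_smul, Nat.cast_succ]
    congr 1
    ring

/-- Iterates of an operator preserving `U` stay in `U`. [folklore] -/
private lemma pow_apply_mem {V : Type*} [AddCommGroup V] [Module ℂ V] (E : Module.End ℂ V)
    (U : Submodule ℂ V) (hE : ∀ u ∈ U, E u ∈ U) {x : V} (hx : x ∈ U) (r : ℕ) :
    (E ^ r) x ∈ U := by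
  induction r with
  | zero => simpa using hx
  | succ r ih =>
    rw [pow_succ', Module.End.mul_apply]
    exact hE _ ih

/-- **Highest weight vectors exist in finite-dimensional stable subspaces.** Let `E, K₁, K₂` be
endomorphisms of a complex vector space with `[K₁, E] = E`, `[K₂, E] = -E`, `[K₁, K₂] = 0`, and
let `U ≠ 0` be a finite-dimensional subspace stable under `E, K₁, K₂`. Then there is a non-zero
`v ∈ U` with `E v = 0` which is a common eigenvector of `K₁` and `K₂`. Proof: a common
eigenvector `u₀ ∈ U` of the commuting pair `K₁, K₂` exists (algebraic closedness of `ℂ`); the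
non-zero vectors among `E ^ r u₀` are `K₁`-eigenvectors for the distinct eigenvalues `μ₁ + r`,
hence linearly independent in `U`, so some `E ^ (r + 1) u₀` vanishes with `E ^ r u₀ ≠ 0`.
[folklore] -/
theorem exists_highestWeightVector :
    ∀ {V : Type} [AddCommGroup V] [Module ℂ V] (E K₁ K₂ : Module.End ℂ V),
      K₁ * E - E * K₁ = E → K₂ * E - E * K₂ = -E → K₁ * K₂ = K₂ * K₁ →
      ∀ (U : Submodule ℂ V), FiniteDimensional ℂ U → U ≠ ⊥ →
      (∀ u ∈ U, E u ∈ U) → (∀ u ∈ U, K₁ u ∈ U) → (∀ u ∈ U, K₂ u ∈ U) →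
      ∃ v ∈ U, v ≠ 0 ∧ E v = 0 ∧ ∃ μ₁ μ₂ : ℂ, K₁ v = μ₁ • v ∧ K₂ v = μ₂ • v := by
  intro V _ _ E K₁ K₂ h₁ h₂ h₁₂ U hU hU₀ hE hK₁ hK₂
  haveI : FiniteDimensional ℂ U := hU
  haveI : Nontrivial U := Submodule.nontrivial_iff_ne_bot.mpr hU₀
  -- Step 1: a common eigenvector `u₀ ∈ U` of `K₁` and `K₂` (restrict to `U`).
  obtain ⟨u₀, hu₀U, hu₀, μ₁, μ₂, hK₁u₀, hK₂u₀⟩ :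
      ∃ u₀ ∈ U, u₀ ≠ 0 ∧ ∃ μ₁ μ₂ : ℂ, K₁ u₀ = μ₁ • u₀ ∧ K₂ u₀ = μ₂ • u₀ := by
    have hcomm : K₁.restrict hK₁ * K₂.restrict hK₂ = K₂.restrict hK₂ * K₁.restrict hK₁ := by
      ext x
      simp only [Module.End.mul_apply, LinearMap.coe_restrict_apply]
      rw [← Module.End.mul_apply, h₁₂, Module.End.mul_apply]
    obtain ⟨w, hw₀, a, b, ha, hb⟩ :=
      exists_common_eigenvector (K₁.restrict hK₁) (K₂.restrict hK₂) hcomm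
    refine ⟨(w : V), w.2, fun h => hw₀ (Subtype.ext h), a, b, ?_, ?_⟩
    · simpa only [LinearMap.coe_restrict_apply, Submodule.coe_smul] using congrArg Subtype.val ha
    · simpa only [LinearMap.coe_restrict_apply, Submodule.coe_smul] using congrArg Subtype.val hb
  -- Step 2: the commutation relations in applied form.
  have hK₁E : ∀ x : V, K₁ (E x) = E (K₁ x) + (1 : ℂ) • E x := fun x => by
    have h := LinearMap.congr_fun h₁ x
    simp only [LinearMap.sub_apply, Module.End.mul_apply] at h
    rw [one_smul]
    exact sub_eq_iff_eq_add'.mp h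
  have hK₂E : ∀ x : V, K₂ (E x) = E (K₂ x) + (-1 : ℂ) • E x := fun x => by
    have h := LinearMap.congr_fun h₂ x
    simp only [LinearMap.sub_apply, Module.End.mul_apply, LinearMap.neg_apply] at h
    rw [neg_one_smul]
    exact sub_eq_iff_eq_add'.mp h
  -- Step 3: the ladder `E ^ r u₀` and its weights.
  have hmem : ∀ r : ℕ, (E ^ r) u₀ ∈ U := pow_apply_mem E U hE hu₀U
  have hw₁ : ∀ r : ℕ, K₁ ((E ^ r) u₀) = (μ₁ + r * 1) • (E ^ r) u₀ :=
    weight_pow_apply E K₁ 1 hK₁E hK₁u₀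
  have hw₂ : ∀ r : ℕ, K₂ ((E ^ r) u₀) = (μ₂ + r * (-1)) • (E ^ r) u₀ :=
    weight_pow_apply E K₂ (-1) hK₂E hK₂u₀
  -- Step 4: some `E ^ (r + 1) u₀` vanishes with `E ^ r u₀ ≠ 0`.
  obtain ⟨r, hr₀, hr₁⟩ := Nat.exists_not_and_succ_of_not_zero_of_exists
    (p := fun r => (E ^ r) u₀ = 0) (by simpa using hu₀)
    (exists_eq_zero_of_weights_injective K₁ U _ _ (injective_weights μ₁ 1 one_ne_zero) hmem hw₁)
  refine ⟨(E ^ r) u₀, hmem r, hr₀, ?_, μ₁ + r * 1, μ₂ + r * (-1), hw₁ r, hw₂ r⟩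
  rwa [pow_succ', Module.End.mul_apply] at hr₁

/-- **Highest weights are natural numbers (locally finite version).** Let `(E, F, H)` be an
`𝔰𝔩₂`-triple of endomorphisms (`[H, E] = 2E`, `[H, F] = -2F`, `[E, F] = H`) of a complex vector
space, `U` a finite-dimensional `F`-stable subspace, and `v ∈ U` a non-zero vector with `E v = 0`
and `H v = μ v`. Then `μ = n` for a natural number `n` and `F ^ (n + 1) v = 0`. Proof (as in
Mathlib's `IsSl2Triple.HasPrimitiveVectorWith.exists_nat`, run inside `U`): the string
`v_i = F ^ i v ∈ U` satisfies `H v_i = (μ - 2 i) v_i` and `E v_{i+1} = (i + 1) (μ - i) v_i`; its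
non-zero members are linearly independent, so `v_{N+1} = 0 ≠ v_N` for some `N`, and then
`(N + 1) (μ - N) v_N = E v_{N+1} = 0` forces `μ = N`. The relation `[H, E] = 2E` is not needed.
[folklore] -/
theorem weight_eq_nat_of_highestWeightVector :
    ∀ {V : Type} [AddCommGroup V] [Module ℂ V] (E F H : Module.End ℂ V),
      H * E - E * H = (2 : ℂ) • E → H * F - F * H = -((2 : ℂ) • F) → E * F - F * E = H →
      ∀ (U : Submodule ℂ V), FiniteDimensional ℂ U → (∀ u ∈ U, F u ∈ U) →
      ∀ (v : V) (μ : ℂ), v ∈ U → v ≠ 0 → E v = 0 → H v = μ • v →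
      ∃ n : ℕ, μ = n ∧ (F ^ (n + 1)) v = 0 := by
  intro V _ _ E F H _hHE hHF hEF U hU hF v μ hvU hv₀ hEv hHv
  haveI : FiniteDimensional ℂ U := hU
  -- The relations in applied form.
  have hHF' : ∀ x : V, H (F x) = F (H x) + (-2 : ℂ) • F x := fun x => by
    have h := LinearMap.congr_fun hHF x
    simp only [LinearMap.sub_apply, Module.End.mul_apply, LinearMap.neg_apply,
      LinearMap.smul_apply] at h
    rw [neg_smul]
    exact sub_eq_iff_eq_add'.mp h
  have hEF' : ∀ x : V, E (F x) = F (E x) + H x := fun x => by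
    have h := LinearMap.congr_fun hEF x
    simp only [LinearMap.sub_apply, Module.End.mul_apply] at h
    exact sub_eq_iff_eq_add'.mp h
  -- The string `F ^ i v` and its weights.
  have hmem : ∀ i : ℕ, (F ^ i) v ∈ U := pow_apply_mem F U hF hvU
  have hwH : ∀ i : ℕ, H ((F ^ i) v) = (μ + i * (-2)) • (F ^ i) v :=
    weight_pow_apply F H (-2) hHF' hHv
  have hwE : ∀ i : ℕ, E ((F ^ (i + 1)) v) = ((i + 1) * (μ - i)) • (F ^ i) v := by
    intro i
    induction i with
    | zero =>
      rw [zero_add, pow_one, pow_zero, Module.End.one_apply, hEF', hEv, map_zero, zero_add, hHv,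
        Nat.cast_zero, zero_add, sub_zero, one_mul]
    | succ i ih =>
      rw [pow_succ' F (i + 1), Module.End.mul_apply, hEF', ih, map_smul, hwH (i + 1),
        ← Module.End.mul_apply F (F ^ i), ← pow_succ', ← add_smul]
      congr 1
      push_cast
      ring
  -- Some `F ^ (N + 1) v` vanishes with `F ^ N v ≠ 0`.
  obtain ⟨N, hN₀, hN₁⟩ := Nat.exists_not_and_succ_of_not_zero_of_exists
    (p := fun i => (F ^ i) v = 0) (by simpa using hv₀)
    (exists_eq_zero_of_weights_injective H U _ _ (injective_weights μ (-2) (by norm_num)) hmem hwH)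
  refine ⟨N, ?_, hN₁⟩
  have h := hwE N
  rw [hN₁, map_zero, eq_comm, smul_eq_zero] at h
  rcases h with h | h
  · rcases mul_eq_zero.mp h with h' | h'
    · exact absurd h' (Nat.cast_add_one_ne_zero N)
    · exact sub_eq_zero.mp h'
  · exact absurd h hN₀

end Literature.Algebra.Lie.GL2Pair
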